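import Mathlib.Analysis.SpecialFunctions.Pow.Real
import Mathlib.Analysis.SpecialFunctions.Log.Basic
import Mathlib.RingTheory.Polynomial.Eisenstein.Basic
import Mathlib.NumberTheory.PrimeCounting
import Mathlib.Data.Nat.Factorization.Basic
import Mathlib.Data.Nat.Prime.Int
import Mathlib.Algebra.Field.ZMod
import Mathlib.Algebra.Polynomial.Roots
import Mathlib.Tactic.IntervalCases
import Literature.NumberTheory.Sieve.LargestPrimeFactorCubic
import HarnessLib

/-!
# Heath-Brown 2001, Lemma 2.2 (the Chebyshev–Hooley step) — I: local densities of `n³ + 2`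

Topic `Literature/NumberTheory/Sieve`; first of three files (`…Local`, `…Mertens`, `…Chebyshev`)
PROVING the lemma of D. R. Heath-Brown, *The largest prime factor of `X³ + 2`*, Proc. London
Math. Soc. (3) 82 (2001) 554–596, that turns "the `3X`-smooth part of `n³ + 2` is `≥ X^{1+δ}` for
`≥ αX` of the `n ∈ (X, 2X]`" into "`n³ + 2` has a prime factor `≥ X^{1+αδ/2}` for
`≥ (δα² + o(1))X` of them", restated as Lemma 2.2 of A. J. Irving, *The largest prime factor of
`X³ + 2`*, arXiv:1412.0024 = Acta Arith. 171 (2015), p. 4: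

> **Lemma 2.2** ([Heath-Brown 2001]). Suppose `α, δ > 0` and that we can find at least `αX`
> elements `n + ∛2 ∈ 𝒜 = {n + ∛2 : X < n ≤ 2X}` for which
> `log^{(1)}(n³ + 2) := ∑_{P^e ∥ (n + ∛2), N(P) ≤ 3X} log N(P^e) ≥ (1 + δ) log X`.
> The number of `n + ∛2 ∈ 𝒜` which have a prime ideal factor `P` with `N(P) ≥ X^{1+αδ/2}` is
> then at least `(δα² + o(1))X`.

By Irving's Lemma 2.1 (= Heath-Brown's description of the ideals dividing `n + ∛2`: degree-one
primes with pairwise distinct norms, `N(n + ∛2) = n³ + 2`) both quantities are rational: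
`log^{(1)}(n³ + 2) = ∑_{p ≤ 3X} v_p(n³ + 2) log p` and "`P ∣ n + ∛2`, `N(P) ≥ Y`" is
"`p ∣ n³ + 2`, `p ≥ Y`".  We prove the lemma in this rational form (file `…Chebyshev`), by the
Chebyshev–Hooley device: `∑_{X<n≤2X} log(n³+2) ≥ 3X log X`, while the prime ideal theorem for
`ℚ(∛−2)` (the tree's `Literature.NumberTheory.LFunctions.DegreeOnePrimes.abs_sum_primesLE_rootCount_mul_log_sub_self_le_logPow`)
gives `∑_n log^{(1)}(n³+2) ≤ X log X + O(X)` (file `…Mertens`), so the primes `> 3X` carry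
`≥ 2X log X − O(X)`; at most two of them (with multiplicity) divide one `n³ + 2 < (3X)³`, whence
the count.  Heath-Brown's paper is not held (paywalled); the proof here is a reconstruction from
the statement printed by Irving, and the constant `δα²` comes out exactly.

This file: the LOCAL inputs, all elementary and all proved —
* `irreducible_X_pow_three_add_two` (Eisenstein at `2`), feeding the tree's prime ideal theorem;
* `rootCount_prime_le_three`, `rootCount_primePow_le_three`: `#{r mod p^e : p^e ∣ r³+2} ≤ 3`
  (Lagrange over `𝔽_p`; Hensel uniqueness for `p ≥ 5`; `4 ∤ r³ + 2`, `9 ∤ r³ + 2`) — the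
  rational content of Irving's Lemma 2.1 ("`ρ(I) = 1`", "not divisible by `P₂²` or `P₃²`");
* `card_dvd_Ioc_le`: `#{X < n ≤ 2X : q ∣ n³+2} ≤ ν(q) (X/q + 2)`;
* size and splitting facts for `log(n³+2) = log^{(1)} + log^{(2)}` and the bound
  `log^{(2)} ≤ 2 log Z` when `n³ + 2` has no prime factor `≥ Z`.

## References

* D. R. Heath-Brown, Proc. London Math. Soc. (3) 82 (2001) 554–596, Lemmas behind Thm. 1.
  [`HeathBrown2001LargestPrimeFactorCubic`]
* A. J. Irving, arXiv:1412.0024 (Acta Arith. 171 (2015) 67–80), §2, Lemmas 2.1–2.2 (p. 4).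
  [`Irving2014LargestPrimeFactorCubic`]
-/

noncomputable section

open Finset Real Polynomial

namespace Literature.NumberTheory.Sieve.LargestPrimeFactorCubic

/-! ### The polynomial `X³ + 2` -/

/-- `X³ + 2 ∈ ℤ[X]` is monic. [folklore] -/
theorem monic_X_pow_three_add_two : (X ^ 3 + C 2 : ℤ[X]).Monic :=
  monic_X_pow_add_C 2 three_ne_zero

/-- `X³ + 2` is Eisenstein at `2`. [folklore] -/
theorem isEisensteinAt_X_pow_three_add_two :
    (X ^ 3 + C 2 : ℤ[X]).IsEisensteinAt (Ideal.span {(2 : ℤ)}) := by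
  refine ⟨?_, fun {n} hn => ?_, ?_⟩
  · rw [monic_X_pow_three_add_two.leadingCoeff, Ideal.mem_span_singleton]; norm_num
  · rw [natDegree_X_pow_add_C] at hn
    interval_cases n <;> simp [coeff_X_pow]
  · rw [Ideal.span_singleton_pow, Ideal.mem_span_singleton]
    simp [coeff_X_pow]

/-- `X³ + 2` is irreducible over `ℤ` (Eisenstein), so that the prime ideal theorem of the tree
applies to its root counts. [folklore] -/
theorem irreducible_X_pow_three_add_two : Irreducible (X ^ 3 + C 2 : ℤ[X]) :=
  isEisensteinAt_X_pow_three_add_two.irreducible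
    (Ideal.span_singleton_prime (by norm_num) |>.2 Int.prime_two)
    monic_X_pow_three_add_two.isPrimitive (by rw [natDegree_X_pow_add_C]; norm_num)

/-- `(q : ℤ) ∣ (X³ + 2)(n)` iff `q ∣ n³ + 2` in `ℕ` (the root-count currency of
`DegreeOnePrimesPNT`). [folklore] -/
theorem intCast_dvd_eval_iff (q n : ℕ) :
    (q : ℤ) ∣ (X ^ 3 + C 2 : ℤ[X]).eval (n : ℤ) ↔ q ∣ n ^ 3 + 2 := by
  simp only [eval_add, eval_pow, eval_X, eval_C]
  rw [show ((n : ℤ) ^ 3 + 2) = ((n ^ 3 + 2 : ℕ) : ℤ) by push_cast; ring, Int.natCast_dvd_natCast]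

/-- The tree's root count `#{n < p : (p:ℤ) ∣ (X³+2)(n)}` is `ν(p) = #{r < p : p ∣ r³ + 2}`.
[folklore] -/
theorem rootCount_eq (q : ℕ) :
    #((range q).filter fun n : ℕ => (q : ℤ) ∣ (X ^ 3 + C 2 : ℤ[X]).eval (n : ℤ)) =
      #{r ∈ range q | q ∣ r ^ 3 + 2} := by
  congr 1
  exact filter_congr fun r _ => intCast_dvd_eval_iff q r

/-! ### Root counts modulo primes and prime powers (Irving's Lemma 2.1, rational content) -/

/-- `q ∣ (r mod q)³ + 2 ↔ q ∣ r³ + 2`. [folklore] -/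
theorem dvd_mod_cube_add_two_iff (q r : ℕ) : q ∣ (r % q) ^ 3 + 2 ↔ q ∣ r ^ 3 + 2 := by
  rw [← ZMod.natCast_eq_zero_iff, ← ZMod.natCast_eq_zero_iff]
  push_cast
  rw [ZMod.natCast_mod]

/-- **Lagrange**: `ν(p) = #{r < p : p ∣ r³ + 2} ≤ 3` for `p` prime (`X³ + 2` has at most three
roots in `𝔽_p`). [cite: Irving2014LargestPrimeFactorCubic, Lemma 2.1] -/
theorem rootCount_prime_le_three {p : ℕ} (hp : p.Prime) : #{r ∈ range p | p ∣ r ^ 3 + 2} ≤ 3 := by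
  classical
  haveI := Fact.mk hp
  set Φ : (ZMod p)[X] := X ^ 3 + C 2 with hΦ
  have hΦ0 : Φ ≠ 0 := (monic_X_pow_add_C (2 : ZMod p) three_ne_zero).ne_zero
  have heval : ∀ r : ℕ, p ∣ r ^ 3 + 2 → Φ.IsRoot (r : ZMod p) := by
    intro r hr
    have h0 : ((r ^ 3 + 2 : ℕ) : ZMod p) = 0 := (ZMod.natCast_eq_zero_iff _ _).mpr hr
    push_cast at h0
    simpa [IsRoot.def, hΦ] using h0
  calc #{r ∈ range p | p ∣ r ^ 3 + 2} ≤ #Φ.roots.toFinset := by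
        refine card_le_card_of_injOn (fun r => (r : ZMod p)) (fun r hr => ?_) ?_
        · rw [mem_coe, mem_filter] at hr
          rw [mem_coe, Multiset.mem_toFinset, mem_roots hΦ0]
          exact heval r hr.2
        · intro r hr r' hr' h
          rw [mem_coe, mem_filter, mem_range] at hr hr'
          have h' : r % p = r' % p := (ZMod.natCast_eq_natCast_iff' r r' p).1 h
          rwa [Nat.mod_eq_of_lt hr.1, Nat.mod_eq_of_lt hr'.1] at h'
    _ ≤ Multiset.card Φ.roots := Multiset.toFinset_card_le _
    _ ≤ Φ.natDegree := card_roots' Φ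
    _ = 3 := by rw [hΦ]; exact natDegree_X_pow_add_C

/-- `4 ∤ r³ + 2` (so `2 ∥ n³ + 2` for even `n`: Irving's "not divisible by `P₂²`"). [cite: Irving2014LargestPrimeFactorCubic, Lemma 2.1] -/
theorem not_four_dvd_cube_add_two (r : ℕ) : ¬ 4 ∣ r ^ 3 + 2 := by
  have key : ∀ x : ZMod 4, x ^ 3 + 2 ≠ 0 := by decide
  intro h
  have h0 : ((r ^ 3 + 2 : ℕ) : ZMod 4) = 0 := (ZMod.natCast_eq_zero_iff _ _).mpr h
  push_cast at h0
  exact key _ h0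

/-- `9 ∤ r³ + 2` (so `3 ∥ n³ + 2` when `3 ∣ n³ + 2`: "not divisible by `P₃²`"). [cite: Irving2014LargestPrimeFactorCubic, Lemma 2.1] -/
theorem not_nine_dvd_cube_add_two (r : ℕ) : ¬ 9 ∣ r ^ 3 + 2 := by
  have key : ∀ x : ZMod 9, x ^ 3 + 2 ≠ 0 := by decide
  intro h
  have h0 : ((r ^ 3 + 2 : ℕ) : ZMod 9) = 0 := (ZMod.natCast_eq_zero_iff _ _).mpr h
  push_cast at h0
  exact key _ h0

/-- **Hensel uniqueness** for `X³ + 2` at a prime `p ≥ 5`: two roots modulo `p^e` that agree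
modulo `p` are equal (`r³ − s³ = (r − s)(r² + rs + s²)` and `r² + rs + s² ≡ 3r² ≢ 0 (mod p)`).
[cite: Irving2014LargestPrimeFactorCubic, Lemma 2.1] -/
theorem root_unique_of_mod_eq {p e r s : ℕ} (hp : p.Prime) (hp2 : p ≠ 2) (hp3 : p ≠ 3)
    (hr : p ^ e ∣ r ^ 3 + 2) (hs : p ^ e ∣ s ^ 3 + 2) (hsr : s ≤ r) (hre : r < p ^ e)
    (hmod : r % p = s % p) : r = s := by
  haveI := Fact.mk hp
  rcases Nat.eq_zero_or_pos e with rfl | he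
  · rw [pow_zero] at hre; omega
  have he0 : p ∣ p ^ e := dvd_pow_self p he.ne'
  -- `p ∤ r² + rs + s²`
  have hnd : ¬ p ∣ r ^ 2 + r * s + s ^ 2 := by
    intro hd
    have h0 : ((r ^ 2 + r * s + s ^ 2 : ℕ) : ZMod p) = 0 := (ZMod.natCast_eq_zero_iff _ _).mpr hd
    have hrs : (r : ZMod p) = (s : ZMod p) := (ZMod.natCast_eq_natCast_iff' r s p).2 hmod
    push_cast at h0
    rw [← hrs] at h0
    have h3 : (3 : ZMod p) * (r : ZMod p) ^ 2 = 0 := by linear_combination h0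
    rcases mul_eq_zero.1 h3 with h3 | h3
    · have : ((3 : ℕ) : ZMod p) = 0 := by exact_mod_cast h3
      rw [ZMod.natCast_eq_zero_iff] at this
      exact hp3 ((Nat.prime_dvd_prime_iff_eq hp Nat.prime_three).1 this)
    · have hr0 : (r : ZMod p) = 0 := pow_eq_zero_iff (n := 2) (by norm_num) |>.1 h3
      rw [ZMod.natCast_eq_zero_iff] at hr0
      have h1 : p ∣ r ^ 3 + 2 := he0.trans hr
      have h2 : p ∣ r ^ 3 := (hr0.trans (dvd_pow_self r three_ne_zero))
      have : p ∣ 2 := (Nat.dvd_add_right h2).1 h1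
      exact hp2 ((Nat.prime_dvd_prime_iff_eq hp Nat.prime_two).1 this)
  have hcop : Nat.Coprime (p ^ e) (r ^ 2 + r * s + s ^ 2) :=
    ((Nat.Prime.coprime_iff_not_dvd hp).2 hnd).pow_left e
  have h1 : p ^ e ∣ (r ^ 3 + 2) - (s ^ 3 + 2) := Nat.dvd_sub hr hs
  have h2 : (r ^ 3 + 2) - (s ^ 3 + 2) = (r - s) * (r ^ 2 + r * s + s ^ 2) := by
    have hs3 : s ^ 3 ≤ r ^ 3 := Nat.pow_le_pow_left hsr 3
    zify [hsr, hs3, Nat.add_le_add_right hs3 2]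
    ring
  rw [h2] at h1
  have h4 : p ^ e ∣ r - s := hcop.dvd_of_dvd_mul_right h1
  have h5 : r - s = 0 := Nat.eq_zero_of_dvd_of_lt h4 (by omega)
  omega

/-- `ν(p^e) = #{r < p^e : p^e ∣ r³ + 2} ≤ 3` for every prime power (`e ≥ 1`): for `p ≥ 5` the
roots inject into the roots modulo `p` (Hensel), for `p = 2, 3` there are none once `e ≥ 2`.
(Irving's Lemma 2.1: "`ρ(I) = 1`" for the admissible ideals.) [cite: Irving2014LargestPrimeFactorCubic, Lemma 2.1] -/
theorem rootCount_primePow_le_three {p : ℕ} (hp : p.Prime) (e : ℕ) :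
    #{r ∈ range (p ^ e) | p ^ e ∣ r ^ 3 + 2} ≤ 3 := by
  by_cases hsmall : p ^ e ≤ 3
  · exact (card_filter_le _ _).trans (by simpa using hsmall)
  push Not at hsmall
  have he2 : p ≤ 3 → 2 ≤ e := by
    intro hp3
    by_contra he
    push Not at he
    interval_cases e
    · simp at hsmall
    · rw [pow_one] at hsmall; omega
  by_cases hp2 : p = 2
  · subst hp2
    have h4 : 4 ∣ 2 ^ e := by
      rw [show (4 : ℕ) = 2 ^ 2 by norm_num]; exact Nat.pow_dvd_pow 2 (he2 (by norm_num))
    rw [filter_false_of_mem fun r _ h => not_four_dvd_cube_add_two r (h4.trans h)]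
    simp
  by_cases hp3 : p = 3
  · subst hp3
    have h9 : 9 ∣ 3 ^ e := by
      rw [show (9 : ℕ) = 3 ^ 2 by norm_num]; exact Nat.pow_dvd_pow 3 (he2 (by norm_num))
    rw [filter_false_of_mem fun r _ h => not_nine_dvd_cube_add_two r (h9.trans h)]
    simp
  -- `p ≥ 5`: reduce modulo `p`
  have hpe : p ∣ p ^ e := by
    rcases Nat.eq_zero_or_pos e with rfl | he
    · simp at hsmall
    · exact dvd_pow_self p he.ne'
  refine le_trans ?_ (rootCount_prime_le_three hp)
  refine card_le_card_of_injOn (fun r => r % p) (fun r hr => ?_) ?_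
  · rw [mem_coe, mem_filter] at hr
    rw [mem_coe, mem_filter, mem_range]
    exact ⟨Nat.mod_lt _ hp.pos, (dvd_mod_cube_add_two_iff p r).2 (hpe.trans hr.2)⟩
  · intro r hr s hs h
    rw [mem_coe, mem_filter, mem_range] at hr hs
    rcases le_total s r with hsr | hrs
    · exact root_unique_of_mod_eq hp hp2 hp3 hr.2 hs.2 hsr hr.1 h
    · exact (root_unique_of_mod_eq hp hp2 hp3 hs.2 hr.2 hrs hs.1 h.symm).symm

/-! ### Counting `n ∈ (X, 2X]` with `q ∣ n³ + 2` -/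

/-- A residue class meets `(X, 2X]` in at most `X/q + 2` integers. [folklore] -/
theorem card_Ioc_filter_mod_eq_le (X : ℕ) {q : ℕ} (hq : 0 < q) (r : ℕ) :
    #{n ∈ Ioc X (2 * X) | n % q = r} ≤ X / q + 2 := by
  calc #{n ∈ Ioc X (2 * X) | n % q = r} ≤ #(Icc (X / q) (2 * X / q)) := by
        refine card_le_card_of_injOn (fun n => n / q) (fun n hn => ?_) ?_
        · rw [mem_coe, mem_filter, mem_Ioc] at hn
          rw [mem_coe, mem_Icc]
          exact ⟨Nat.div_le_div_right hn.1.1.le, Nat.div_le_div_right hn.1.2⟩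
        · intro n hn n' hn' h
          rw [mem_coe, mem_filter] at hn hn'
          have h1 := Nat.div_add_mod n q
          have h2 := Nat.div_add_mod n' q
          simp only at h
          rw [h, hn.2] at h1
          rw [hn'.2] at h2
          omega
    _ = 2 * X / q + 1 - X / q := Nat.card_Icc _ _
    _ ≤ X / q + 2 := by
        have h2 : 2 * X / q ≤ X / q + X / q + 1 := by
          have := Nat.add_div hq (a := X) (b := X)
          rw [← two_mul] at this
          split_ifs at this <;> omega
        generalize X / q = a at h2 ⊢
        generalize 2 * X / q = b at h2 ⊢
        omega

/-- `N(q) := #{X < n ≤ 2X : q ∣ n³ + 2} ≤ ν(q) · (X/q + 2)`, `ν(q) = #{r < q : q ∣ r³ + 2}`: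
split `n` by its residue `r = n mod q`. [folklore] -/
theorem card_dvd_Ioc_le (X : ℕ) {q : ℕ} (hq : 0 < q) :
    #{n ∈ Ioc X (2 * X) | q ∣ n ^ 3 + 2} ≤ #{r ∈ range q | q ∣ r ^ 3 + 2} * (X / q + 2) := by
  rw [card_eq_sum_card_fiberwise (f := fun n => n % q) (t := range q)
    (fun n _ => mem_range.2 (Nat.mod_lt _ hq))]
  have hfib : ∀ r ∈ range q,
      #{n ∈ {n ∈ Ioc X (2 * X) | q ∣ n ^ 3 + 2} | n % q = r} ≤
        if q ∣ r ^ 3 + 2 then X / q + 2 else 0 := by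
    intro r _
    split_ifs with hr
    · refine le_trans (card_le_card ?_) (card_Ioc_filter_mod_eq_le X hq r)
      intro n hn
      simp only [mem_filter] at hn ⊢
      exact ⟨hn.1.1, hn.2⟩
    · rw [Nat.le_zero, card_eq_zero, filter_eq_empty_iff]
      intro n hn h
      rw [mem_filter] at hn
      exact hr (h ▸ (dvd_mod_cube_add_two_iff q n).2 hn.2)
  refine (sum_le_sum hfib).trans ?_
  rw [← sum_filter, sum_const, smul_eq_mul]

/-- `N(q) = 0` for `q > 8X³ + 2` (every `n³ + 2`, `n ≤ 2X`, is `≤ 8X³ + 2 < q`). [folklore] -/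
theorem card_dvd_Ioc_eq_zero {X q : ℕ} (hq : 8 * X ^ 3 + 2 < q) :
    #{n ∈ Ioc X (2 * X) | q ∣ n ^ 3 + 2} = 0 := by
  rw [card_eq_zero, filter_eq_empty_iff]
  intro n hn h
  rw [mem_Ioc] at hn
  have h1 : n ^ 3 + 2 ≤ 8 * X ^ 3 + 2 := by
    have : n ^ 3 ≤ (2 * X) ^ 3 := Nat.pow_le_pow_left hn.2 3
    nlinarith
  exact absurd (Nat.le_of_dvd (by positivity) h) (by omega)

/-! ### Sizes of `n³ + 2` on `(X, 2X]` -/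

/-- For `X < n ≤ 2X`: `X³ < n³ + 2 ≤ 8X³ + 2 < (3X)³`. [folklore] -/
theorem cube_add_two_bounds {X n : ℕ} (hn : n ∈ Ioc X (2 * X)) :
    X ^ 3 < n ^ 3 + 2 ∧ n ^ 3 + 2 ≤ 8 * X ^ 3 + 2 ∧ 8 * X ^ 3 + 2 < (3 * X) ^ 3 := by
  rw [mem_Ioc] at hn
  have h1 : X ^ 3 < n ^ 3 := Nat.pow_lt_pow_left hn.1 three_ne_zero
  have h2 : n ^ 3 ≤ (2 * X) ^ 3 := Nat.pow_le_pow_left hn.2 3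
  have hX : 1 ≤ X := by omega
  have hX3 : 1 ≤ X ^ 3 := Nat.one_le_pow _ _ hX
  refine ⟨by omega, by nlinarith, ?_⟩
  nlinarith

/-- `3 log X ≤ log(n³ + 2) ≤ 3 log X + log 9` for `X < n ≤ 2X`, `X ≥ 2`. [folklore] -/
theorem log_cube_add_two_bounds {X n : ℕ} (hX : 2 ≤ X) (hn : n ∈ Ioc X (2 * X)) :
    3 * Real.log X ≤ Real.log ((n ^ 3 + 2 : ℕ) : ℝ) ∧
      Real.log ((n ^ 3 + 2 : ℕ) : ℝ) ≤ 3 * Real.log X + Real.log 9 := by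
  obtain ⟨h1, h2, -⟩ := cube_add_two_bounds hn
  have hX0 : (0 : ℝ) < X := by exact_mod_cast (show 0 < X by omega)
  have h9 : (8 * X ^ 3 + 2 : ℕ) ≤ 9 * X ^ 3 := by
    have : 2 ^ 3 ≤ X ^ 3 := Nat.pow_le_pow_left hX 3
    omega
  have hlog3 : 3 * Real.log X = Real.log ((X : ℝ) ^ 3) := by
    rw [Real.log_pow]; norm_num
  rw [hlog3]
  constructor
  · exact Real.log_le_log (by positivity) (by exact_mod_cast h1.le)
  · rw [← Real.log_mul (by positivity) (by norm_num)]
    refine Real.log_le_log (by positivity) ?_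
    have : ((n ^ 3 + 2 : ℕ) : ℝ) ≤ ((9 * X ^ 3 : ℕ) : ℝ) := by exact_mod_cast h2.trans h9
    push_cast at this ⊢
    linarith

/-! ### `log(n³+2) = log^{(1)} + log^{(2)}` and the bound on `log^{(2)}` off `𝓑` -/

/-- `log m = ∑_{p ∣ m} v_p(m) log p` over the prime factors (Mathlib's
`Real.log_nat_eq_sum_factorization`, unfolded). [folklore] -/
theorem log_eq_sum_primeFactors (m : ℕ) :
    Real.log m = ∑ p ∈ m.primeFactors, (m.factorization p : ℝ) * Real.log (p : ℝ) := by
  rw [Real.log_nat_eq_sum_factorization, Finsupp.sum, Nat.support_factorization]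

/-- The smooth part of the logarithm over the primes `≤ Y` only sees prime factors:
`∑_{p ≤ Y} v_p(m) log p = ∑_{p ∣ m, p ≤ Y} v_p(m) log p`. [folklore] -/
theorem sum_primesLE_factorization_mul_log (m Y : ℕ) :
    ∑ p ∈ Nat.primesLE Y, (m.factorization p : ℝ) * Real.log (p : ℝ) =
      ∑ p ∈ m.primeFactors.filter (fun p : ℕ => p ≤ Y),
        (m.factorization p : ℝ) * Real.log (p : ℝ) := by
  symm
  refine sum_subset (fun p hp => ?_) (fun p hp hpn => ?_)
  · rw [mem_filter, Nat.mem_primeFactors] at hp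
    exact Nat.mem_primesLE.2 ⟨hp.2, hp.1.1⟩
  · have : m.factorization p = 0 := by
      rw [← Finsupp.notMem_support_iff, Nat.support_factorization]
      intro h
      exact hpn (mem_filter.2 ⟨h, (Nat.mem_primesLE.1 hp).1⟩)
    simp [this]

/-- **Splitting** `log(n³+2) = log^{(1)} + log^{(2)}`: with
`log^{(1)} = ∑_{p ≤ 3X} v_p(n³+2) log p`, the remainder is
`log^{(2)} = ∑_{p ∣ n³+2, p > 3X} v_p(n³+2) log p`. [cite: Irving2014LargestPrimeFactorCubic, §2 (definition of log^{(1)})] -/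
theorem log_sub_smoothLog_eq (X n : ℕ) :
    Real.log ((n ^ 3 + 2 : ℕ) : ℝ) -
        ∑ p ∈ Nat.primesLE (3 * X), ((n ^ 3 + 2).factorization p : ℝ) * Real.log (p : ℝ) =
      ∑ p ∈ (n ^ 3 + 2).primeFactors.filter (fun p : ℕ => ¬ p ≤ 3 * X),
        ((n ^ 3 + 2).factorization p : ℝ) * Real.log ((p : ℕ) : ℝ) := by
  rw [sum_primesLE_factorization_mul_log, log_eq_sum_primeFactors,
    ← sum_filter_add_sum_filter_not _ (fun p => p ≤ 3 * X)]
  ring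

/-- The number of prime factors `> 3X` of `n³ + 2`, `X < n ≤ 2X`, counted with multiplicity, is
at most `2` (their product divides `n³ + 2 < (3X)³`). [cite: Irving2014LargestPrimeFactorCubic, §2] -/
theorem sum_factorization_large_le_two {X n : ℕ} (hn : n ∈ Ioc X (2 * X)) :
    ∑ p ∈ (n ^ 3 + 2).primeFactors.filter (fun p : ℕ => ¬ p ≤ 3 * X),
      (n ^ 3 + 2).factorization p ≤ 2 := by
  set m := n ^ 3 + 2 with hm
  obtain ⟨-, h2, h3⟩ := cube_add_two_bounds hn
  set s := m.primeFactors.filter (fun p => ¬ p ≤ 3 * X) with hs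
  have hm0 : m ≠ 0 := by positivity
  -- `(3X)^{Ω} < ∏_{p ∈ s} p^{v_p} ≤ m < (3X)^3`
  have hprod : ∏ p ∈ s, p ^ m.factorization p ∣ m := by
    conv_rhs => rw [← Nat.prod_factorization_pow_eq_self hm0]
    rw [Finsupp.prod, Nat.support_factorization]
    exact prod_dvd_prod_of_subset _ _ _ (filter_subset _ _)
  have hle : (3 * X) ^ (∑ p ∈ s, m.factorization p) ≤ ∏ p ∈ s, p ^ m.factorization p := by
    rw [← prod_pow_eq_pow_sum]
    refine prod_le_prod' fun p hp => ?_
    rw [hs, mem_filter] at hp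
    exact Nat.pow_le_pow_left (by omega) _
  have hlt : (3 * X) ^ (∑ p ∈ s, m.factorization p) < (3 * X) ^ 3 :=
    lt_of_le_of_lt (hle.trans (Nat.le_of_dvd (by positivity) hprod)) (h2.trans_lt h3)
  have h3X : 1 < 3 * X := by rw [mem_Ioc] at hn; omega
  exact Nat.le_of_lt_succ ((Nat.pow_lt_pow_iff_right h3X).1 hlt)

/-- **`log^{(2)} ≤ 2 log Z` off `𝓑`**: if every prime factor of `n³ + 2` (`X < n ≤ 2X`) is `< Z`
(`Z ≥ 1` real), then `log(n³+2) − log^{(1)}(n³+2) ≤ 2 log Z`. [cite: Irving2014LargestPrimeFactorCubic, Lemma 2.2] -/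
theorem log_sub_smoothLog_le_of_no_large_prime {X n : ℕ} (hn : n ∈ Ioc X (2 * X)) {Z : ℝ}
    (hZ : 1 ≤ Z) (hnoZ : ∀ p : ℕ, p.Prime → p ∣ n ^ 3 + 2 → (p : ℝ) < Z) :
    Real.log ((n ^ 3 + 2 : ℕ) : ℝ) -
        ∑ p ∈ Nat.primesLE (3 * X), ((n ^ 3 + 2).factorization p : ℝ) * Real.log (p : ℝ) ≤
      2 * Real.log Z := by
  rw [log_sub_smoothLog_eq]
  have hΩ := sum_factorization_large_le_two hn
  set s := (n ^ 3 + 2).primeFactors.filter (fun p : ℕ => ¬ p ≤ 3 * X)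
  have hlogZ : 0 ≤ Real.log Z := Real.log_nonneg hZ
  calc ∑ p ∈ s, ((n ^ 3 + 2).factorization p : ℝ) * Real.log ((p : ℕ) : ℝ)
      ≤ ∑ p ∈ s, ((n ^ 3 + 2).factorization p : ℝ) * Real.log Z := by
        refine sum_le_sum fun p hp => ?_
        have hp' := (mem_filter.1 hp).1
        rw [Nat.mem_primeFactors] at hp'
        refine mul_le_mul_of_nonneg_left ?_ (Nat.cast_nonneg _)
        exact Real.log_le_log (by exact_mod_cast hp'.1.pos) (hnoZ p hp'.1 hp'.2.1).le
    _ = (∑ p ∈ s, (n ^ 3 + 2).factorization p : ℕ) * Real.log Z := by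
        rw [Nat.cast_sum, sum_mul]
    _ ≤ 2 * Real.log Z := by
        refine mul_le_mul_of_nonneg_right ?_ hlogZ
        exact_mod_cast hΩ

/-- `log^{(1)} ≥ 0`. [folklore] -/
theorem smoothLog_nonneg (X n : ℕ) :
    0 ≤ ∑ p ∈ Nat.primesLE (3 * X), ((n ^ 3 + 2).factorization p : ℝ) * Real.log (p : ℝ) :=
  sum_nonneg fun p hp => mul_nonneg (Nat.cast_nonneg _)
    (Real.log_nonneg (by exact_mod_cast (Nat.mem_primesLE.1 hp).2.one_lt.le))

/-- `log^{(2)} ≥ 0`, i.e. `log^{(1)}(n³+2) ≤ log(n³+2)`. [folklore] -/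
theorem smoothLog_le_log (X n : ℕ) :
    ∑ p ∈ Nat.primesLE (3 * X), ((n ^ 3 + 2).factorization p : ℝ) * Real.log (p : ℝ) ≤
      Real.log ((n ^ 3 + 2 : ℕ) : ℝ) := by
  rw [← sub_nonneg, log_sub_smoothLog_eq]
  refine sum_nonneg fun p hp => mul_nonneg (Nat.cast_nonneg _) (Real.log_nonneg ?_)
  have hp' := (mem_filter.1 hp).1
  exact_mod_cast (Nat.prime_of_mem_primeFactors hp').one_lt.le

end Literature.NumberTheory.Sieve.LargestPrimeFactorCubic
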